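import Mathlib
import Summits.NavierStokesRegularity.NavierStokesRegularity.Theorems.FilamentSkeletonRssClause13ModelSelfForm

/-!
# Clause 13-J, brick B4/B5 (virial): the WEIGHTED VIRIAL IDENTITY `2Re⟨W·Y′, Y⟩ = −⟨W′Y, Y⟩`
# and the transport commutator `2Re⟨−wY′, (τ−c)Y⟩ = ⟨(w + (τ−c)w′)Y, Y⟩`

Route `FilamentSkeletonRss`, child `Clause13NearStraightL` (stmt-NavierStokesRegularity-23321; typing-agnostic, valid verbatim for the
A1G twin 28296); design of record `filament-plan/DESIGN-NOTE-28296-tenure-g22.md` §4: in the virial identity with conjugate operator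
`A = τ − c` the transport part `−w∂_τ` of the linearised operator contributes the BOUNDED MULTIPLIER `[(τ−c), −w∂_τ] = +w` ("the transport
term does NOT fight this estimate").  Integrated form, for a real `C¹` weight `W` and `Y : ℝ → ℂ` with derivative `Y′`:

  `∫ W·(conj Y′·Y + conj Y·Y′) = −∫ W′·conj Y·Y`      (the derivative of `W|Y|²` integrates to `0`),

and with `W = (τ−c)·w` (so `W′ = w + (τ−c)w′`):  `∫ (τ−c)w·2Re(conj Y·Y′) = −∫ (w + (τ−c)w′)|Y|²`, i.e.
`2Re⟨−wY′, (τ−c)Y⟩_{L²} = ∫ (w + (τ−c)w′)|Y|²` — the multiplier `w` of the note plus the explicit slope correction `(τ−c)w′`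
(bounded by `Λ·R/cg` on the ball in the class, `|w′| ≤ Λ`).  The case `w ≡ 1` is the dilation identity
(`…Clause13DilationIdentity`).
Lane ns-filament-19175-p1 g14; `--supports stmt-NavierStokesRegularity-23321 --as helper`.
HONEST FRAMING: elementary identities attached to a HYPOTHETICAL filament skeleton's linearised operator on the NEGATIVE side of a
MODEL route; nothing here bears on Navier–Stokes regularity or blow-up.
-/

noncomputable section

open MeasureTheory Real Complex Filter Set
open scoped ComplexConjugate

namespace Summit.NavierStokesRegularity.NavierStokesRegularity.Theorems.MatchedKernel
set_option linter.dupNamespace false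

/-- Derivative of `τ ↦ W(τ)·conj Y(τ)·Y(τ)` for a real weight `W`. [folklore] -/
theorem hasDerivAt_realWeight_mul_conj_mul {Y Y' : ℝ → ℂ} {W W' : ℝ → ℝ} (hY : ∀ τ, HasDerivAt Y (Y' τ) τ)
    (hW : ∀ τ, HasDerivAt W (W' τ) τ) (τ : ℝ) :
    HasDerivAt (fun s : ℝ => ((W s : ℝ) : ℂ) * (conj (Y s) * Y s))
      (((W' τ : ℝ) : ℂ) * (conj (Y τ) * Y τ) + ((W τ : ℝ) : ℂ) * (conj (Y' τ) * Y τ + conj (Y τ) * Y' τ)) τ := by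
  have h1 : HasDerivAt (fun s : ℝ => ((W s : ℝ) : ℂ)) ((W' τ : ℝ) : ℂ) τ := (hW τ).ofReal_comp
  have hconj : HasDerivAt (fun s : ℝ => conj (Y s)) (conj (Y' τ)) τ := (hY τ).star
  have h2 : HasDerivAt (fun s : ℝ => conj (Y s) * Y s) (conj (Y' τ) * Y τ + conj (Y τ) * Y' τ) τ :=
    hconj.fun_mul (hY τ)
  exact h1.fun_mul h2

/-- **WEIGHTED VIRIAL IDENTITY (complex form)**: `∫ W(conj Y′·Y + conj Y·Y′) = −∫ W′·conj Y·Y` for a real `C¹` weight `W`,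
under integrability of `W|Y|²`, `W′|Y|²`, `W(conj Y′·Y + conj Y·Y′)`. [folklore] -/
theorem integral_realWeight_mul_deriv_sq_eq {Y Y' : ℝ → ℂ} {W W' : ℝ → ℝ} (hY : ∀ τ, HasDerivAt Y (Y' τ) τ)
    (hW : ∀ τ, HasDerivAt W (W' τ) τ)
    (hg : Integrable (fun τ : ℝ => ((W τ : ℝ) : ℂ) * (conj (Y τ) * Y τ)))
    (h0 : Integrable (fun τ : ℝ => ((W' τ : ℝ) : ℂ) * (conj (Y τ) * Y τ)))
    (h1 : Integrable (fun τ : ℝ => ((W τ : ℝ) : ℂ) * (conj (Y' τ) * Y τ + conj (Y τ) * Y' τ))) :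
    ∫ τ : ℝ, ((W τ : ℝ) : ℂ) * (conj (Y' τ) * Y τ + conj (Y τ) * Y' τ)
      = -∫ τ : ℝ, ((W' τ : ℝ) : ℂ) * (conj (Y τ) * Y τ) := by
  have hzero := integral_eq_zero_of_hasDerivAt_of_integrable (hasDerivAt_realWeight_mul_conj_mul hY hW) (h0.add h1) hg
  rw [integral_add h0 h1] at hzero
  linear_combination hzero

/-- **WEIGHTED VIRIAL IDENTITY (real form)**: `∫ W·2Re(conj Y·Y′) = −∫ W′·|Y|²`. [folklore] -/
theorem integral_realWeight_mul_two_re_eq {Y Y' : ℝ → ℂ} {W W' : ℝ → ℝ} (hY : ∀ τ, HasDerivAt Y (Y' τ) τ)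
    (hW : ∀ τ, HasDerivAt W (W' τ) τ)
    (hg : Integrable (fun τ : ℝ => ((W τ : ℝ) : ℂ) * (conj (Y τ) * Y τ)))
    (h0 : Integrable (fun τ : ℝ => ((W' τ : ℝ) : ℂ) * (conj (Y τ) * Y τ)))
    (h1 : Integrable (fun τ : ℝ => ((W τ : ℝ) : ℂ) * (conj (Y' τ) * Y τ + conj (Y τ) * Y' τ))) :
    ∫ τ : ℝ, W τ * (2 * (conj (Y τ) * Y' τ).re) = -∫ τ : ℝ, W' τ * ‖Y τ‖ ^ 2 := by
  have h := integral_realWeight_mul_deriv_sq_eq hY hW hg h0 h1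
  have hadd : ∀ a b : ℂ, conj b * a + conj a * b = ((2 * (conj a * b).re : ℝ) : ℂ) := by
    intro a b
    have h' : conj b * a = conj (conj a * b) := by rw [map_mul, Complex.conj_conj, mul_comm]
    rw [h', add_comm, Complex.add_conj]
  have hl : ∫ τ : ℝ, ((W τ : ℝ) : ℂ) * (conj (Y' τ) * Y τ + conj (Y τ) * Y' τ)
      = ((∫ τ : ℝ, W τ * (2 * (conj (Y τ) * Y' τ).re) : ℝ) : ℂ) := by
    rw [← integral_complex_ofReal]
    refine integral_congr_ae (Eventually.of_forall fun τ => ?_)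
    dsimp only
    rw [hadd, ← Complex.ofReal_mul]
  have hr : ∫ τ : ℝ, ((W' τ : ℝ) : ℂ) * (conj (Y τ) * Y τ) = ((∫ τ : ℝ, W' τ * ‖Y τ‖ ^ 2 : ℝ) : ℂ) := by
    rw [← integral_complex_ofReal]
    refine integral_congr_ae (Eventually.of_forall fun τ => ?_)
    dsimp only
    rw [Complex.conj_mul', Complex.ofReal_mul, Complex.ofReal_pow]
  rw [hl, hr, ← Complex.ofReal_neg] at h
  exact_mod_cast h

/-- **TRANSPORT COMMUTATOR (note §4, `[(τ−c), −w∂_τ] = +w` in quadratic form):** with `W = (τ−c)·w`,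
`∫ (τ−c)·w·2Re(conj Y·Y′) = −∫ (w + (τ−c)·w′)·|Y|²`, i.e. `2Re⟨−wY′, (τ−c)Y⟩ = ∫ (w + (τ−c)w′)|Y|²`. [folklore] -/
theorem transport_virial_eq {Y Y' : ℝ → ℂ} {w w' : ℝ → ℝ} (hY : ∀ τ, HasDerivAt Y (Y' τ) τ)
    (hw : ∀ τ, HasDerivAt w (w' τ) τ) (c : ℝ)
    (hg : Integrable (fun τ : ℝ => (((τ - c) * w τ : ℝ) : ℂ) * (conj (Y τ) * Y τ)))
    (h0 : Integrable (fun τ : ℝ => ((w τ + (τ - c) * w' τ : ℝ) : ℂ) * (conj (Y τ) * Y τ)))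
    (h1 : Integrable (fun τ : ℝ => (((τ - c) * w τ : ℝ) : ℂ) * (conj (Y' τ) * Y τ + conj (Y τ) * Y' τ))) :
    ∫ τ : ℝ, (τ - c) * w τ * (2 * (conj (Y τ) * Y' τ).re) = -∫ τ : ℝ, (w τ + (τ - c) * w' τ) * ‖Y τ‖ ^ 2 := by
  have hW : ∀ τ, HasDerivAt (fun s : ℝ => (s - c) * w s) (w τ + (τ - c) * w' τ) τ := by
    intro τ
    have h := ((hasDerivAt_id τ).sub_const c).mul (hw τ)
    refine h.congr_deriv ?_
    simp only [id_eq, one_mul]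
  exact integral_realWeight_mul_two_re_eq (W := fun s => (s - c) * w s) (W' := fun s => w s + (s - c) * w' s) hY hW hg h0 h1

end Summit.NavierStokesRegularity.NavierStokesRegularity.Theorems.MatchedKernel

end
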